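import Mathlib
import HarnessLib.Audit
import Summits.PneNP.PneNP.Theorems.PstarGateBridge
import Summits.PneNP.PneNP.Theorems.PstarChordBridgeTerminalData
import Summits.PneNP.PneNP.Theorems.PstarCrossBlind

/-!
# Gate bridge data from the raw E2 terminal datum: `TerminalFiveCotree1Blind`'s hypotheses ⟹ bridge data with `GateHyp` and one gate (ROUND-25, O2 / E2; prover-1 g18)

FRONTIER range-avoidance ladder, rung F-N3 (`stmt-PneNP-19007`), cell `pnp-ideate` (this seat's `HOME/pnp-ideate-prover-1/g18/E2-PLAN.md` §1, §7 (a));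
restricted-model proof complexity — nothing here bears on `P` versus `NP`.

The glue between the node `PstarCoupled.TerminalFiveCotree1Blind` (terminal pair `(w₁, w₂)` on `J₀`, ONE cotree-partner gate `g₀ = x_v · x_u` of `w₁`
with `v` a private of the chord `e`, `u` an AND-input of a cotree edge, everything else hun-clean, `w₂` blind to the privates of `e`, `v, u` free on `Z`)
and the abstract one-gate layer (`PstarGateBridge`, `PstarGateCaseT`, `PstarGateCaseTLocal`): for the orientation `v = vars e 2`,

* `gateBridge_of_terminal` — bridge data `B` (`PstarChordBridgeAssemble.exists_bridgeData`, which needs only "no cross pendant": the gate is not cross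
  because `u` is no private) with `B.J₀ = J₀`, `B.N = J₀ ∖ F`, the constraints of `w₁, w₂`, `B.WF I`, `Lift I B`, pendants off the core, `N ≠ ∅`,
  (T3)/(M0) in `Solution` form, **`GateHyp I B e`** (the mate `v' = vars e 3` is unread by `w₁` by the fibre lemma `PstarCrossBlind.or_shape_at` at a
  point of `Z` with `x_v = 0`, supplied by the freeness of `v`) and **the single-gate coefficient `coef I C₁ G₁ v x = [v ∈ w₁.1] + x_u`**.

The orientation `v = vars e 3` is symmetric (swap the two privates of `e` in the model) and not spelled out here.
-/

set_option linter.dupNamespace false -- `Summit.PneNP.PneNP.…`: summit = sub-problem name (D-0017 single-conjunct layout)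

open Finset Literature.Computability.Complexity
open Summit.PneNP.PneNP.Theorems.PstarTyped (Typed)
open Summit.PneNP.PneNP.Theorems.PstarSALevel (varSet bdry BoundaryExpanding SimpleOverlap)
open Summit.PneNP.PneNP.Theorems.PstarGapPeeling (not_mem_varSet_of_private)
open Summit.PneNP.PneNP.Theorems.PstarCentreFree (vars_mem_varSet)
open Summit.PneNP.PneNP.Theorems.PstarGapOneAll (gval)
open Summit.PneNP.PneNP.Theorems.PstarCoreBound (XorClosed)
open Summit.PneNP.PneNP.Theorems.PstarChordRepair (IsChord)
open Summit.PneNP.PneNP.Theorems.PstarChordBridgeCotree (Peelable sdiff_nonempty_of_xorClosed)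
open Summit.PneNP.PneNP.Theorems.PstarChordBridgeTools (privs mem_privs vars_mem_privs coef)
open Summit.PneNP.PneNP.Theorems.PstarChordBridge (BridgeData sys Solution Lift)
open Summit.PneNP.PneNP.Theorems.PstarChordBridgeTerminal (HasConstraints)
open Summit.PneNP.PneNP.Theorems.PstarChordBridgeAssemble (exists_bridgeData)
open Summit.PneNP.PneNP.Theorems.PstarCoreBoundTargets (Terminal)
open Summit.PneNP.PneNP.Theorems.PstarUnion (SatPair)
open Summit.PneNP.PneNP.Theorems.PstarChordReadShared (gval_singleton)
open Summit.PneNP.PneNP.Theorems.PstarCrossBlind (or_shape_at)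
open Summit.PneNP.PneNP.Theorems.PstarGateBridge (GateHyp)

namespace Summit.PneNP.PneNP.Theorems.PstarGateTerminal

variable {n m : ℕ}

/-- The read coefficient with exactly one monomial touching `p`, of AND pair `(p, u)` or `(u, p)`: `coef = [p ∈ C] + x_u`. -/
theorem coef_single_gate (I : LocalMap 4 n m) (hI : I.IsPure xorAndPred) {C : Finset (Fin n)} {G : Finset (Fin m)} {g₀ : Fin m} (hg₀ : g₀ ∈ G)
    {p u : Fin n} (hgv : (I.vars g₀ 2 = p ∧ I.vars g₀ 3 = u) ∨ (I.vars g₀ 2 = u ∧ I.vars g₀ 3 = p))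
    (hothers : ∀ g ∈ G.erase g₀, I.vars g 2 ≠ p ∧ I.vars g 3 ≠ p) (x : Fin n → ZMod 2) :
    coef I C G p x = (if p ∈ C then 1 else 0) + x u := by
  classical
  unfold coef
  congr 1
  rw [← add_sum_erase G _ hg₀, sum_eq_zero fun g hg => by rw [if_neg (hothers g hg).1, if_neg (hothers g hg).2, add_zero], add_zero]
  have hpu : p ≠ u := by
    rcases hgv with ⟨h2, h3⟩ | ⟨h2, h3⟩
    · rw [← h2, ← h3]; exact fun h => absurd (hI.2 g₀ h) (by decide)
    · rw [← h2, ← h3]; exact fun h => absurd (hI.2 g₀ h.symm) (by decide)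
  rcases hgv with ⟨h2, h3⟩ | ⟨h2, h3⟩
  · rw [if_pos h2, h3, if_neg (fun h : u = p => hpu h.symm), add_zero]
  · rw [h2, if_neg (fun h : u = p => hpu h.symm), if_pos h3, zero_add]

/-- **Gate bridge data from the raw E2 terminal datum** (orientation `v = vars e 2`).  See the module docstring. -/
theorem gateBridge_of_terminal (I : LocalMap 4 n m) (hI : I.IsPure xorAndPred) (hT : Typed I) (hS : SimpleOverlap I) {r : ℕ}
    (hB : BoundaryExpanding r I) {y : Fin m → Bool} {J₀ : Finset (Fin m)} {w₁ w₂ : Finset (Fin n) × Finset (Fin m) × Bool}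
    (ht : Terminal I r y J₀ w₁ w₂) {F : Finset (Fin m)} (hF : F ⊆ J₀) (hP : Peelable I F)
    (hmax : ∀ F', F ⊆ F' → F' ⊆ J₀ → Peelable I F' → F' = F) (hch : ∀ e ∈ J₀ \ F, IsChord I J₀ e)
    {e : Fin m} (he : e ∈ J₀ \ F) {g₀ : Fin m} (hg₀ : g₀ ∈ w₁.2.1) {u : Fin n}
    (hgv : (I.vars g₀ 2 = I.vars e 2 ∧ I.vars g₀ 3 = u) ∨ (I.vars g₀ 2 = u ∧ I.vars g₀ 3 = I.vars e 2))
    (hu : ∃ j₀ ∈ F, u = I.vars j₀ 2 ∨ u = I.vars j₀ 3)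
    (hun : ∀ g ∈ (w₁.2.1.erase g₀) ∪ w₂.2.1, ∀ w ∈ privs I (J₀ \ F), I.vars g 2 ≠ w ∧ I.vars g 3 ≠ w)
    (hfv : ∀ c : Bool, SatPair I y J₀ (({I.vars e 2} : Finset (Fin n)), (∅ : Finset (Fin m)), c) w₂)
    (hbl : I.vars e 2 ∉ w₂.1 ∧ I.vars e 3 ∉ w₂.1) :
    ∃ B : BridgeData n m, B.y = y ∧ B.J₀ = J₀ ∧ B.N = J₀ \ F ∧ HasConstraints B w₁ w₂ ∧ B.WF I ∧ Lift I B ∧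
      Peelable I (B.J₀ \ B.N) ∧ Disjoint B.G₁ B.J₀ ∧ Disjoint B.G₂ B.J₀ ∧ B.N.Nonempty ∧ GateHyp I B e ∧
      (∀ x, coef I B.C₁ B.G₁ (I.vars e 2) x = (if I.vars e 2 ∈ w₁.1 then 1 else 0) + x u) ∧
      (¬ ∃ z, Solution I B B.J₀ z) ∧ (∀ f ∈ B.J₀, ∃ z, Solution I B (B.J₀.erase f) z) := by
  classical
  obtain ⟨hne0, hX, hJr, hd₁, hd₂, hrad, hT3, hM0⟩ := id ht
  set v := I.vars e 2 with hvdef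
  set v' := I.vars e 3 with hv'def
  have heJ : e ∈ J₀ := (mem_sdiff.1 he).1
  have hvpriv : v ∈ privs I (J₀ \ F) := vars_mem_privs I he (s := 2) (by decide)
  have hv'priv : v' ∈ privs I (J₀ \ F) := vars_mem_privs I he (s := 3) (by decide)
  -- `u` is inside `F`: no private
  obtain ⟨j₀, hj₀, hju⟩ := hu
  have hj₀J : j₀ ∈ J₀ := hF hj₀
  have hu_vs : u ∈ varSet I j₀ := by
    rcases hju with h | h <;> rw [h] <;> exact vars_mem_varSet I j₀ _
  have hu_npriv : u ∉ privs I (J₀ \ F) := by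
    intro hup
    obtain ⟨e₁, he₁, h⟩ := (mem_privs I).1 hup
    have he₁J : e₁ ∈ J₀ := (mem_sdiff.1 he₁).1
    have hne : j₀ ≠ e₁ := fun hh => (mem_sdiff.1 he₁).2 (hh ▸ hj₀)
    rcases h with h | h
    · exact not_mem_varSet_of_private I he₁J hj₀J hne (hch e₁ he₁).1 (vars_mem_varSet I e₁ 2) (h ▸ hu_vs)
    · exact not_mem_varSet_of_private I he₁J hj₀J hne (hch e₁ he₁).2 (vars_mem_varSet I e₁ 3) (h ▸ hu_vs)
  have huv : u ≠ v := fun h => hu_npriv (h ▸ hvpriv)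
  have huv' : u ≠ v' := fun h => hu_npriv (h ▸ hv'priv)
  -- no cross pendant
  have hcross : ∀ g ∈ w₁.2.1 ∪ w₂.2.1, ¬ (I.vars g 2 ∈ privs I (J₀ \ F) ∧ I.vars g 3 ∈ privs I (J₀ \ F)) := by
    intro g hg ⟨h2, h3⟩
    rcases mem_union.1 hg with hg | hg
    · by_cases hgg : g = g₀
      · subst hgg
        rcases hgv with ⟨-, hg3⟩ | ⟨hg2, -⟩
        · exact hu_npriv (hg3 ▸ h3)
        · exact hu_npriv (hg2 ▸ h2)
      · exact (hun g (mem_union_left _ (mem_erase.2 ⟨hgg, hg⟩)) _ h2).1 rfl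
    · exact (hun g (mem_union_right _ hg) _ h2).1 rfl
  obtain ⟨B, hy, hJ, hN, hC, hW, hL, -, -⟩ :=
    exists_bridgeData I hI hT hS hB y hne0 hJr.le w₁ w₂ hd₁ hd₂ hT3 hM0 hF hP hmax hch hcross
  obtain ⟨h1, h2, h3, h4, h5, h6⟩ := hC
  have hsol : ∀ K z, Solution I B K z ↔
      (∀ j ∈ K, I.eval z j = y j) ∧ gval I w₁.1 w₁.2.1 z = w₁.2.2 ∧ gval I w₂.1 w₂.2.1 z = w₂.2.2 := by
    intro K z
    unfold Solution
    rw [hy, h1, h2, h3, h4, h5, h6]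
  -- the mate `v'` is unread by `w₁` (fibre lemma at a free point with `x_v = 0`)
  have hT3' : ∀ z : Fin n → Bool, (∀ j ∈ J₀, I.eval z j = y j) → gval I w₂.1 w₂.2.1 z = w₂.2.2 → gval I w₁.1 w₁.2.1 z ≠ w₁.2.2 :=
    fun z hz hzw h1' => hT3 ⟨z, hz, h1', hzw⟩
  have hm₁ : ∀ g ∈ w₁.2.1.erase g₀, I.vars g 2 ≠ v ∧ I.vars g 3 ≠ v ∧ I.vars g 2 ≠ v' ∧ I.vars g 3 ≠ v' := fun g hg =>
    ⟨(hun g (mem_union_left _ hg) v hvpriv).1, (hun g (mem_union_left _ hg) v hvpriv).2,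
      (hun g (mem_union_left _ hg) v' hv'priv).1, (hun g (mem_union_left _ hg) v' hv'priv).2⟩
  have hw₂v : v ∉ w₂.1 ∧ v' ∉ w₂.1 ∧ ∀ g ∈ w₂.2.1, I.vars g 2 ≠ v ∧ I.vars g 3 ≠ v ∧ I.vars g 2 ≠ v' ∧ I.vars g 3 ≠ v' :=
    ⟨hbl.1, hbl.2, fun g hg => ⟨(hun g (mem_union_right _ hg) v hvpriv).1, (hun g (mem_union_right _ hg) v hvpriv).2,
      (hun g (mem_union_right _ hg) v' hv'priv).1, (hun g (mem_union_right _ hg) v' hv'priv).2⟩⟩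
  obtain ⟨z₀, hz₀J, hz₀0, hz₀w⟩ := hfv false
  have hz₀v : z₀ v = false := by
    have h : gval I {v} ∅ z₀ = false := hz₀0
    rwa [gval_singleton] at h
  have hv'C : v' ∉ w₁.1 :=
    (or_shape_at I hI hT3' heJ (hch e he) (Or.inl ⟨rfl, rfl⟩) hg₀ hgv huv huv' hm₁ hw₂v hz₀J hz₀w hz₀v).1
  refine ⟨B, hy, hJ, hN, ⟨h1, h2, h3, h4, h5, h6⟩, hW, hL, ?_, ?_, ?_, ?_, ?_, ?_, ?_, ?_⟩
  · rw [hJ, hN, Finset.sdiff_sdiff_eq_self hF]; exact hP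
  · rw [h2, hJ]; exact hd₁.symm
  · rw [h5, hJ]; exact hd₂.symm
  · rw [hN]; exact sdiff_nonempty_of_xorClosed I hT hX hne0 hF hP
  · -- `GateHyp`
    refine ⟨by rw [hN]; exact he, ?_, ?_, ?_, ?_, ?_⟩
    · intro w hw hwv
      rw [hN] at hw
      rw [h2, h5]
      refine ⟨fun g hg => ?_, fun g hg => hun g (mem_union_right _ hg) w hw⟩
      by_cases hgg : g = g₀
      · subst hgg
        have hwu : w ≠ u := fun h => hu_npriv (h ▸ hw)
        rcases hgv with ⟨hg2, hg3⟩ | ⟨hg2, hg3⟩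
        · exact ⟨fun h => hwv (h.symm.trans hg2), fun h => hwu (h.symm.trans hg3)⟩
        · exact ⟨fun h => hwu (h.symm.trans hg2), fun h => hwv (h.symm.trans hg3)⟩
      · exact hun g (mem_union_left _ (mem_erase.2 ⟨hgg, hg⟩)) w hw
    · rw [h5]; exact fun g hg => ⟨(hw₂v.2.2 g hg).1, (hw₂v.2.2 g hg).2.1⟩
    · rw [h4]; exact hbl.1
    · rw [h1]; exact hv'C
    · rw [h4]; exact hbl.2
  · -- the single-gate coefficient
    intro x
    rw [h1, h2]
    exact coef_single_gate I hI hg₀ hgv (fun g hg => ⟨(hm₁ g hg).1, (hm₁ g hg).2.1⟩) x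
  · rw [hJ]
    rintro ⟨z, hz⟩
    exact hT3 ⟨z, (hsol J₀ z).1 hz⟩
  · rw [hJ]
    intro f hf
    obtain ⟨z, hz⟩ := hM0 f hf
    exact ⟨z, (hsol _ z).2 hz⟩

end Summit.PneNP.PneNP.Theorems.PstarGateTerminal
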